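import Mathlib
import Summits.CriticalPhenomena.SAWScalingLimit.Theorems.SAWDefectDecoherenceConjugateClassNegligibleSums
import Literature.Barriers.CriticalPhenomena.ParafermionicHalfCauchyRiemann
import Literature.Probability.RandomPlanarGeometry.HexParafermionProofs
import Literature.Probability.RandomPlanarGeometry.ConformalMap
import Literature.Probability.RandomPlanarGeometry.PlanarDomains
import Literature.Probability.RandomPlanarGeometry.CaratheodoryHalfPlaneProofs
import HarnessLib

/-!
# Crux `HexObservableLimitR` (stmt-CriticalPhenomena-14003), line `Ideator1Sketch` — stub `stub_densityIntegrable`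

Registered stub of the lead skeleton `Cruxes/HexObservableLimitR/Lines/Ideator1Sketch.lean`
(composition `HexObservableLimitR_of`). Target file: `Summits/CriticalPhenomena/SAWScalingLimit/Theorems/SAWDefectDecoherenceHexObservableLimitRDensityIntegrable.lean`.

Contents (namespace `Summit.CriticalPhenomena.SAWScalingLimit.Theorems.HexObservableLimitR`):
* `lintegral_enorm_deriv_sq_eq` — the area formula `∫_s ‖f'‖² = area (f s)` for `f` holomorphic on an
  open set `U ⊇ s` and injective on the measurable set `s` (Mathlib's change of variables
  `MeasureTheory.lintegral_abs_det_fderiv_eq_addHaar_image`; the real Jacobian of `w ↦ c w` is `‖c‖²`);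
* `exists_norm_le_of_tendsto_norm_atTop` — a conformal equivalence `Φ : D → ℍₒ` of a Jordan domain with
  `‖Φ‖ → ∞` at a point `a ∈ closure D` is bounded on `D ∖ B(a, r)`: by Carathéodory's theorem in the
  half-plane form PROVED in the tree (`JordanDomain.exists_hasBoundaryValueAtInfty_holds`,
  Pommerenke (1992), Thm. 2.1) `Φ⁻¹` has a boundary value at infinity, which must be `a`;
* `stub_densityIntegrable` — the registered stub: the limit density `e^{(5/8)(L - L_b)}`
  (`|·| = e^{-(5/8) Re L_b} |Φ'|^{5/8}`) is integrable on `Ω ∖ B(a, r)` for every `r > 0`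
  (boundedness of `Φ` there, the area formula, and Hölder / monotonicity of `L^p` exponents on a
  finite-measure set).

No named (unproved) fact is used: the proof is unconditional.
-/

noncomputable section

namespace Summit.CriticalPhenomena.SAWScalingLimit.Theorems.HexObservableLimitR

open Literature.Probability.RandomPlanarGeometry Literature.Probability.RandomPlanarGeometry.SAW
open Literature.Probability.LatticeModels Literature.Barriers.CriticalPhenomena
open Literature.Barriers.CriticalPhenomena.HexGreen
open Summit.CriticalPhenomena.SAWScalingLimit.Theorems.ConjugateClassNegligibleSynthesis
open scoped BigOperators Topology ComplexConjugate
open Filter MeasureTheory Set Metric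

/-- **Area formula for holomorphic injections.** If `f` is holomorphic on an open set `U` and
injective on a measurable set `s ⊆ U`, then `∫_s ‖f'‖² dA = area (f '' s)`: Mathlib's change of
variables `MeasureTheory.lintegral_abs_det_fderiv_eq_addHaar_image` with the real Jacobian
`|det Df| = ‖f'‖²` (the determinant of the `ℝ`-linear map `w ↦ c • w` of `ℂ` is `‖c‖²`, by
`LinearMap.det_restrictScalars` and `Algebra.norm ℝ c = |c|²`). [folklore] -/
theorem lintegral_enorm_deriv_sq_eq {U s : Set ℂ} {f : ℂ → ℂ} (hU : IsOpen U)
    (hf : DifferentiableOn ℂ f U) (hsU : s ⊆ U) (hs : MeasurableSet s) (hinj : InjOn f s) :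
    ∫⁻ z in s, ‖deriv f z‖ₑ ^ 2 = volume (f '' s) := by
  have hdet : ∀ c : ℂ,
      ((ContinuousLinearMap.toSpanSingleton ℂ c).restrictScalars ℝ).det = ‖c‖ ^ 2 := fun c => by
    simp [ContinuousLinearMap.det, LinearMap.det_restrictScalars, Algebra.norm_complex_eq,
      Complex.normSq_eq_norm_sq]
  have key := lintegral_abs_det_fderiv_eq_addHaar_image volume hs
    (f' := fun z => (ContinuousLinearMap.toSpanSingleton ℂ (deriv f z)).restrictScalars ℝ)
    (fun z hz => ((hf.differentiableAt (hU.mem_nhds (hsU hz))).hasDerivAt.hasFDerivAt.restrictScalars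
      ℝ).hasFDerivWithinAt) hinj
  simpa [hdet, ENNReal.ofReal_pow, ofReal_norm] using key

/-- **A conformal map onto `ℍₒ` is bounded away from its pole** (consequence of Carathéodory's
theorem). Let `Φ : D → ℍₒ` be a conformal equivalence of a Jordan domain onto the upper half-plane
with `‖Φ z‖ → ∞` as `z → a` within `D`, for some `a ∈ closure D`. Then `Φ` is bounded on
`D ∖ B(a, r)` for every `r > 0`. Proof: by Carathéodory's theorem in the half-plane form, proved in
the tree (`JordanDomain.exists_hasBoundaryValueAtInfty_holds`; Pommerenke, *Boundary Behaviour of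
Conformal Maps* (1992), Thm. 2.1), `Φ⁻¹` has a boundary value `p` at infinity; composing with
`Φ → ∞` along `𝓝[D] a` gives `p = a`, so `Φ⁻¹ w ∈ B(a, r)` off a compact set of `w`'s.
[cite: PommerenkeBBCM1992, Thm. 2.1] -/
theorem exists_norm_le_of_tendsto_norm_atTop (D : JordanDomain)
    (Φ : ConformalEquiv D.carrier UpperHalfPlane.upperHalfPlaneSet) {a : ℂ}
    (ha : a ∈ closure D.carrier) (hΦa : Tendsto (fun x => ‖Φ x‖) (𝓝[D.carrier] a) atTop)
    {r : ℝ} (hr : 0 < r) :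
    ∃ M : ℝ, ∀ z ∈ D.carrier \ ball a r, ‖Φ z‖ ≤ M := by
  obtain ⟨p, -, hp⟩ := JordanDomain.exists_hasBoundaryValueAtInfty_holds D Φ.symm
  -- `Φ → ∞` within `ℍₒ` along `𝓝[D] a`
  have h1 : Tendsto Φ (𝓝[D.carrier] a) (cocompact ℂ ⊓ 𝓟 UpperHalfPlane.upperHalfPlaneSet) := by
    refine tendsto_inf.2 ⟨?_, tendsto_principal.2 ?_⟩
    · rw [← Metric.cobounded_eq_cocompact]
      exact tendsto_norm_atTop_iff_cobounded.1 hΦa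
    · exact eventually_mem_nhdsWithin.mono fun x hx => Φ.mapsTo hx
  haveI : (𝓝[D.carrier] a).NeBot := mem_closure_iff_nhdsWithin_neBot.1 ha
  -- the boundary value of `Φ⁻¹` at infinity is `a`
  have hpa : p = a := by
    have h2 : Tendsto (Φ.symm ∘ Φ) (𝓝[D.carrier] a) (𝓝 p) := hp.comp h1
    have h3 : (Φ.symm ∘ Φ) =ᶠ[𝓝[D.carrier] a] id :=
      eventually_mem_nhdsWithin.mono fun x hx => Φ.symm_apply_apply hx
    exact tendsto_nhds_unique (h2.congr' h3) (tendsto_id'.2 nhdsWithin_le_nhds)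
  subst hpa
  have hmem : Φ.symm ⁻¹' ball p r ∈ cocompact ℂ ⊓ 𝓟 UpperHalfPlane.upperHalfPlaneSet :=
    hp (ball_mem_nhds p hr)
  rw [Filter.mem_inf_principal, Filter.mem_cocompact] at hmem
  obtain ⟨K, hK, hKsub⟩ := hmem
  obtain ⟨M, hM⟩ := hK.isBounded.subset_closedBall 0
  refine ⟨M, fun z hz => ?_⟩
  by_contra hzM
  have hzK : Φ z ∉ K := fun h => hzM (mem_closedBall_zero_iff.1 (hM h))
  have := hKsub hzK (Φ.mapsTo hz.1)
  rw [mem_preimage, Φ.symm_apply_apply hz.1] at this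
  exact hz.2 this

/-- **The limit density is integrable away from the root.** For a conformal equivalence `Φ` of the
Jordan carrier onto the upper half-plane with a pole at `a = D.pt 0` and a continuous logarithm `L`
of `Φ'`, the density `e^{(5/8)(L - L_b)} = (Φ'/ e^{L_b})^{5/8}` is integrable on `Ω ∖ B(a, r)` for
every `r > 0` (Carathéodory: `Φ` is bounded away from `a`, so `∫ |Φ'|² < ∞` there, and Hölder).
Proof: `|e^{(5/8)(L - L_b)}| = e^{-(5/8) Re L_b} |Φ'|^{5/8}`; `Φ` is bounded by some `M` on
`s = Ω ∖ B(a, r)` (`exists_norm_le_of_tendsto_norm_atTop`, from Carathéodory's theorem proved in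
the tree), so `∫_s |Φ'|² = area (Φ s) ≤ area B(0, M) < ∞` (`lintegral_enorm_deriv_sq_eq`), i.e.
`Φ' ∈ L²(s)`; as `s` has finite area, `Φ' ∈ L^{5/8}(s)` (`MemLp.mono_exponent`), i.e. `|Φ'|^{5/8}`
is integrable on `s`. The flatness, `b`-side and `ρ` hypotheses are not needed. [folklore] -/
theorem stub_densityIntegrable (D : DobrushinDomain) (ρ : ℝ)
    (Φ : ConformalEquiv D.carrier UpperHalfPlane.upperHalfPlaneSet) (L : ℂ → ℂ) (Lb : ℂ)
    (_hρ : 0 < ρ)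
    (_hflat : ∀ i : Fin 2, D.carrier ∩ ball (D.pt i) ρ = {z : ℂ | (D.pt i).im < z.im} ∩ ball (D.pt i) ρ)
    (hΦa : Tendsto (fun x => ‖Φ x‖) (𝓝[D.carrier] (D.pt 0)) atTop)
    (_hΦb : Φ.HasBoundaryValue (D.pt 1) 0)
    (hL : ContinuousOn L D.carrier) (hexpL : ∀ z ∈ D.carrier, Complex.exp (L z) = deriv Φ z)
    (_hLb : Tendsto L (𝓝[D.carrier] (D.pt 1)) (𝓝 Lb)) :
    ∀ r : ℝ, 0 < r →
      IntegrableOn (fun z => Complex.exp ((5 / 8 : ℂ) * (L z - Lb))) (D.carrier \ ball (D.pt 0) r) := by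
  intro r hr
  set s : Set ℂ := D.carrier \ ball (D.pt 0) r with hs_def
  have hsU : s ⊆ D.carrier := sdiff_subset
  have hs : MeasurableSet s := D.isOpen.measurableSet.diff measurableSet_ball
  have hs_fin : volume s < ⊤ := (measure_mono hsU).trans_lt D.isBounded.measure_lt_top
  haveI : IsFiniteMeasure (volume.restrict s) := isFiniteMeasure_restrict.2 hs_fin.ne
  -- `Φ` is bounded on `s` (Carathéodory: `Φ⁻¹ → a` at infinity)
  obtain ⟨M, hM⟩ := exists_norm_le_of_tendsto_norm_atTop D.toJordanDomain Φ
    (frontier_subset_closure (D.pt_mem_frontier 0)) hΦa hr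
  -- hence `∫_s |Φ'|² = area (Φ s) ≤ area B(0, M) < ∞`
  have hlin : ∫⁻ z in s, ‖deriv Φ z‖ₑ ^ 2 < ⊤ := by
    rw [lintegral_enorm_deriv_sq_eq D.isOpen Φ.differentiableOn_coe hsU hs (Φ.injOn.mono hsU)]
    refine (measure_mono ?_).trans_lt (measure_closedBall_lt_top (x := (0 : ℂ)) (r := M))
    rintro _ ⟨z, hz, rfl⟩
    exact mem_closedBall_zero_iff.2 (hM z hz)
  have hderiv_cont : ContinuousOn (deriv Φ) D.carrier :=
    (Φ.differentiableOn_coe.deriv D.isOpen).continuousOn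
  have hmeas : AEStronglyMeasurable (deriv Φ) (volume.restrict s) :=
    (hderiv_cont.mono hsU).aestronglyMeasurable hs
  have hMemLp2 : MemLp (deriv Φ) 2 (volume.restrict s) := by
    refine ⟨hmeas, ?_⟩
    rw [eLpNorm_lt_top_iff_lintegral_rpow_enorm_lt_top two_ne_zero ENNReal.ofNat_ne_top]
    simpa only [ENNReal.toReal_ofNat, ENNReal.rpow_ofNat] using hlin
  -- `s` has finite measure, so `Φ' ∈ L^{5/8}(s)`: `|Φ'|^{5/8}` is integrable on `s`
  have hp : MemLp (deriv Φ) (ENNReal.ofReal (5 / 8)) (volume.restrict s) :=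
    hMemLp2.mono_exponent (by
      rw [show (2 : ENNReal) = ENNReal.ofReal 2 by norm_num]
      exact ENNReal.ofReal_le_ofReal (by norm_num))
  have hint : Integrable (fun z => ‖deriv Φ z‖ ^ (5 / 8 : ℝ)) (volume.restrict s) := by
    have := hp.integrable_norm_rpow (ENNReal.ofReal_pos.2 (by norm_num)).ne' ENNReal.ofReal_ne_top
    simpa only [ENNReal.toReal_ofReal (by norm_num : (0 : ℝ) ≤ 5 / 8)] using this
  -- the density is continuous on `Ω` with modulus `e^{-(5/8) Re L_b} |Φ'|^{5/8}`
  have hg_cont : ContinuousOn (fun z => Complex.exp ((5 / 8 : ℂ) * (L z - Lb))) D.carrier :=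
    (continuousOn_const.mul (hL.sub continuousOn_const)).cexp
  refine Integrable.mono' (hint.const_mul (Real.exp (-(5 / 8) * Lb.re)))
    ((hg_cont.mono hsU).aestronglyMeasurable hs) ?_
  refine (ae_restrict_iff' hs).2 (Eventually.of_forall fun z hz => le_of_eq ?_)
  have hre : ((5 / 8 : ℂ) * (L z - Lb)).re = 5 / 8 * ((L z).re - Lb.re) := by
    rw [show (5 / 8 : ℂ) = ((5 / 8 : ℝ) : ℂ) by push_cast; ring, Complex.re_ofReal_mul,
      Complex.sub_re]
  rw [Complex.norm_exp, ← hexpL z (hsU hz), Complex.norm_exp, ← Real.exp_mul, ← Real.exp_add, hre]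
  congr 1
  ring

end Summit.CriticalPhenomena.SAWScalingLimit.Theorems.HexObservableLimitR

end
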